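import Summits.ResolutionOfSingularities.ResolutionOfSingularities.Theorems.FrobeniusClosingPatchingRelPerfectDepthPhaseCLocalGamePieceStep
import HarnessLib

/-!
# Crux `PatchingRelPerfect` (stmt-ResolutionOfSingularities-16161), chain W5.2 — F7(β) (β-AX) X3 C-I (G2) engine:
# PHANTOM LETTERS — a piece off the centre keeps the FULL global letter list (brick (b2′) `PiecePhantom`)

[OURS · L1 W5.2 · res-D-pv-046 ENGINE NOTE 4 2026-08-27T21:48:11Z CLAIM 1, res-L1-w52-lead-1 RECORD R13-4 (1); line
`Cruxes/PatchingRelPerfect/Lines/closed_point_slice.lean`.]  Replaces the role of NO printed item; NOT a statement of the manuscript under review;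
fact-free; def-free.  AI-written; AI review is weaker than expert review.

In the (G2) engine EVERY presented piece carries the FULL global letter list restricted to it (so that all pieces share the index set
`B = range n` and a permissible `J` of the active piece names the same stratum everywhere).  A piece OFF the centre of a move receives the new
exceptional letter as `𝒪` — a PHANTOM: unpointed, exponent `0` in every row.  THIS FILE:

* `hasSNC_append_top`, `pointedDistinct_append_top`, `monomialSum_map_append_top_zero` — appending the letter `𝒪` (exponent `0`) changes
  neither snc, nor pointed-distinctness, nor the monomial sum;
* `gameInv_phantom` — the Route-K dictionary `GameInv` for the state `⟨insert e B, Str, A⟩` (one more live index, no new stratum, same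
  vectors) on the letters `Es ++ [𝒪]` and the padded rows;
* `wf_phantom` — well-formedness of that state;
* `pieceStep_offCentre_full` — (b2) `pieceStep_offCentre` re-packaged with the FULL transformed letter list `(Λ.map st_τ ++ [Z𝒪])|_{τ⁻¹D}`.

## References (for the mathematics; nothing here is a statement of the manuscript under review)
* E. Bierstone, P. Milman, *Desingularization of toric and binomial varieties*, J. Algebraic Geom. 15 (2006), proof of Thm. 8.5, Lemma 8.7.
  [BierstoneMilman2006]
* J. Kollár, *Lectures on Resolution of Singularities* (2007), (3.111) Step 3. [Kollar2007]
-/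

-- `Summit.<Summit>.<Sub>.Theorems` with `Sub = Summit` (single-conjunct summit, D-0017)
set_option linter.dupNamespace false

noncomputable section

open CategoryTheory AlgebraicGeometry TopologicalSpace IsLocalRing
open Literature.AlgebraicGeometry.Resolution

namespace Summit.ResolutionOfSingularities.ResolutionOfSingularities.Theorems

namespace MonomialCleanup

open DepthTargets (monomialSum monomialSum_nil monomialSum_cons)
open PolyhedraGame (State move weight)

universe u

variable {X : Scheme.{u}}

/-! ## §1 Appending the letter `𝒪` -/

/-- A member of `Es ++ [𝒪]` through a point is a member of `Es` (the unit ideal has empty support). [folklore] -/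
theorem mem_of_mem_append_top {Es : List X.IdealSheafData} {D : X.IdealSheafData} (hD : D ∈ Es ++ [⊤]) {x : X}
    (hx : x ∈ D.support) : D ∈ Es := by
  rcases List.mem_append.mp hD with h | h
  · exact h
  · rw [List.mem_singleton] at h
    subst h
    rw [Scheme.IdealSheafData.support_top] at hx
    have h' : x ∈ ((⊥ : Closeds X) : Set X) := hx
    rw [Closeds.coe_bot] at h'
    exact absurd h' (Set.notMem_empty x)

/-- **Appending `𝒪` keeps simple normal crossings.** [folklore] -/
theorem hasSNC_append_top {Es : List X.IdealSheafData} (h : HasSNC Es) : HasSNC (Es ++ [⊤]) := by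
  intro x
  obtain ⟨hreg, u, hu, ⟨ι, hι, hιD⟩, hC⟩ := h x
  refine ⟨hreg, u, hu, ⟨fun D => ι ⟨D.1, mem_of_mem_append_top D.2.1 D.2.2, D.2.2⟩, fun D₁ D₂ heq => ?_,
    fun D => hιD ⟨D.1, mem_of_mem_append_top D.2.1 D.2.2, D.2.2⟩⟩, hC⟩
  have e := congrArg Subtype.val (hι heq)
  exact Subtype.ext e

/-- Positions of `Es ++ [𝒪]` carrying a point are positions of `Es`. [folklore] -/
theorem lt_length_of_mem_support_nthSheaf_append_top {Es : List X.IdealSheafData} {k : ℕ} (hk : k < Es.length + 1) {x : X}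
    (hx : x ∈ (nthSheaf (Es ++ [⊤]) k).support) : k < Es.length := by
  rcases Nat.lt_succ_iff_lt_or_eq.mp hk with h | h
  · exact h
  · subst h
    rw [nthSheaf_append_length, Scheme.IdealSheafData.support_top] at hx
    have h' : x ∈ ((⊥ : Closeds X) : Set X) := hx
    rw [Closeds.coe_bot] at h'
    exact absurd h' (Set.notMem_empty x)

/-- **Appending `𝒪` keeps pointed-distinctness.** [folklore] -/
theorem pointedDistinct_append_top {Es : List X.IdealSheafData} (h : PointedDistinct Es) : PointedDistinct (Es ++ [⊤]) := by
  intro k k' hk hk' hne x hx hx'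
  rw [List.length_append, List.length_singleton] at hk hk'
  have hk₀ := lt_length_of_mem_support_nthSheaf_append_top hk hx
  have hk₀' := lt_length_of_mem_support_nthSheaf_append_top hk' hx'
  rw [nthSheaf_append_left _ _ hk₀] at hx ⊢
  rw [nthSheaf_append_left _ _ hk₀'] at hx' ⊢
  exact h k k' hk₀ hk₀' hne x hx hx'

/-- **Padding every row with `(𝒪, 0)` does not change the monomial sum.** [folklore] -/
theorem monomialSum_map_append_top_zero (𝒦 : List (List (X.IdealSheafData × ℕ))) :
    monomialSum (𝒦.map fun A => A ++ [((⊤ : X.IdealSheafData), 0)]) = monomialSum 𝒦 := by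
  induction 𝒦 with
  | nil => rfl
  | cons A 𝒦 ih =>
    rw [List.map_cons, monomialSum_cons, monomialSum_cons, ih, monomialIdeal_append,
      monomialIdeal_singleton, pow_zero, Scheme.IdealSheafData.one_eq_top, Scheme.IdealSheafData.mul_top]

/-- The boundary list of a padded row. [folklore] -/
theorem boundaryOf_append_top_zero (A : List (X.IdealSheafData × ℕ)) :
    boundaryOf (A ++ [((⊤ : X.IdealSheafData), 0)]) = boundaryOf A ++ [⊤] := by
  simp [boundaryOf]

/-! ## §2 The dictionary with a phantom letter -/

/-- **THE DICTIONARY WITH A PHANTOM LETTER.**  If `GameInv s Es 𝒦 lab` and `e ∉ s.B` is a fresh index, then the state with one more live index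
`e` (no new stratum, same vectors) is realised by the letters `Es ++ [𝒪]` (the phantom at position `|Es|`, labelled `e`) and the rows padded
with `(𝒪, 0)`. [cite: Kollar2007, (3.111) Step 3] -/
theorem gameInv_phantom {s : State} {Es : List X.IdealSheafData} {𝒦 : List (List (X.IdealSheafData × ℕ))} {lab : ℕ → ℕ}
    (hinv : GameInv s Es 𝒦 lab) {e : ℕ} (he : e ∉ s.B) :
    GameInv ⟨insert e s.B, s.Str, s.A⟩ (Es ++ [⊤]) (𝒦.map fun A => A ++ [((⊤ : X.IdealSheafData), 0)]) (labMove Es lab e) := by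
  have hlen : (Es ++ [(⊤ : X.IdealSheafData)]).length = Es.length + 1 := by
    rw [List.length_append, List.length_singleton]
  -- pointedness and exponents at the positions
  have hpt : ∀ k, k < Es.length + 1 → Pointed (Es ++ [⊤]) k → k < Es.length ∧ Pointed Es k := fun k hk ⟨x, hx⟩ => by
    have hk₀ := lt_length_of_mem_support_nthSheaf_append_top hk hx
    rw [nthSheaf_append_left _ _ hk₀] at hx
    exact ⟨hk₀, x, hx⟩
  have hagree : ∀ A ∈ 𝒦, ∀ α : ℕ →₀ ℕ, Agree Es lab A α → Agree (Es ++ [⊤]) (labMove Es lab e) (A ++ [(⊤, 0)]) α := by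
    intro A hA α h k hk hp
    rw [hlen] at hk
    obtain ⟨hk₀, hp₀⟩ := hpt k hk hp
    have hkA : k < A.length := by rw [hinv.length_eq hA]; exact hk₀
    rw [labMove_lt hk₀, nthExp_append_left _ _ hkA]
    exact h k hk₀ hp₀
  have hlabinj : ∀ k k', k < Es.length + 1 → k' < Es.length + 1 →
      labMove Es lab e k = labMove Es lab e k' → k = k' := by
    intro k k' hk hk' h
    rcases Nat.lt_succ_iff_lt_or_eq.mp hk with hk | rfl
    · rcases Nat.lt_succ_iff_lt_or_eq.mp hk' with hk' | rfl
      · rw [labMove_lt hk, labMove_lt hk'] at h; exact hinv.lab_inj k k' hk hk' h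
      · rw [labMove_lt hk, labMove_length] at h
        exact absurd (h ▸ hinv.lab_mem hk) he
    · rcases Nat.lt_succ_iff_lt_or_eq.mp hk' with hk' | hk'
      · rw [labMove_length, labMove_lt hk'] at h
        exact absurd (h.symm ▸ hinv.lab_mem hk') he
      · exact hk'.symm
  refine ⟨hasSNC_append_top hinv.snc, ?_, pointedDistinct_append_top hinv.pd, ?_, ?_, ?_, ?_, ?_, ?_, ?_⟩
  · intro A' hA'
    obtain ⟨A, hA, rfl⟩ := List.mem_map.mp hA'
    rw [boundaryOf_append_top_zero, hinv.bd A hA]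
  · rw [hlen]; exact hlabinj
  · show insert e s.B = _
    rw [hlen, Finset.range_add_one, Finset.image_insert, labMove_length, hinv.B_eq]
    congr 1
    exact Finset.image_congr fun k hk => (labMove_lt (Finset.mem_range.mp (Finset.mem_coe.mp hk))).symm
  · intro T hT
    exact (hinv.str_B T hT).trans (Finset.subset_insert _ _)
  · intro α hα b hb
    exact Finset.mem_insert_of_mem (hinv.supp α hα b hb)
  · intro S hS ⟨x, hx⟩
    have hS₀ : ∀ k ∈ S, k < Es.length ∧ x ∈ (nthSheaf Es k).support := fun k hkS => by
      have hk := hS k hkS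
      rw [hlen] at hk
      have h := hx k hkS
      have hk₀ := lt_length_of_mem_support_nthSheaf_append_top hk h
      rw [nthSheaf_append_left _ _ hk₀] at h
      exact ⟨hk₀, h⟩
    have himg : S.image (labMove Es lab e) = S.image lab :=
      Finset.image_congr fun k hk => labMove_lt (hS₀ k (Finset.mem_coe.mp hk)).1
    show S.image (labMove Es lab e) ∈ s.Str
    rw [himg]
    exact hinv.str S (fun k hk => (hS₀ k hk).1) ⟨x, fun k hk => (hS₀ k hk).2⟩
  · intro A' hA'
    obtain ⟨A, hA, rfl⟩ := List.mem_map.mp hA'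
    obtain ⟨α, hα, hagr⟩ := hinv.fwd A hA
    exact ⟨α, hα, hagree A hA α hagr⟩
  · intro α hα
    obtain ⟨A, hA, hagr⟩ := hinv.bwd α hα
    exact ⟨_, List.mem_map.mpr ⟨A, hA, rfl⟩, hagree A hA α hagr⟩

/-- **The phantom state is well-formed** when the old one is. [folklore] -/
theorem wf_phantom {s : State} (hs : s.WF) (e : ℕ) : (⟨insert e s.B, s.Str, s.A⟩ : State).WF where
  str_subset := fun T hT => (hs.str_subset T hT).trans (Finset.subset_insert _ _)
  str_down := fun T hT T' hT' => hs.str_down T hT T' hT'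
  support_subset := fun α hα => (hs.support_subset α hα).trans (Finset.subset_insert _ _)
  nonempty := hs.nonempty

/-! ## §3 The move seen from a piece OFF the centre, full letter list -/

/-- **ONE GLOBAL MOVE, SEEN FROM A PIECE OFF THE CENTRE, WITH THE FULL TRANSFORMED LETTER LIST.**  As (b2) `pieceStep_offCentre`, the new
exceptional letter being carried as a phantom: on `τ⁻¹D` the state `⟨insert e B, Str, A⟩` is realised by `(Λ.map st_τ ++ [Z𝒪])|_{τ⁻¹D}` and the
padded pulled-back rows, and the global controlled transform restricts to their monomial sum. [cite: BierstoneMilman2006, proof of Thm. 8.5, Lemma 8.7] -/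
theorem pieceStep_offCentre_full {T : Scheme.{u}} [IsLocallyNoetherian T] (Λ : List T.IdealSheafData) (K Z : T.IdealSheafData)
    (D : T.Opens) (m : ℕ) {s : State} {𝒦 : List (List ((D : Scheme.{u}).IdealSheafData × ℕ))} {lab : ℕ → ℕ}
    (hinv : GameInv s (Λ.map fun F => F.comap D.ι) 𝒦 lab) (hK : K.comap D.ι = monomialSum 𝒦) (hZD : Z.comap D.ι = ⊤)
    {e : ℕ} (he : e ∉ s.B) :
    GameInv ⟨insert e s.B, s.Str, s.A⟩
        ((Λ.map (strictTransformIdeal (blowup.π Z) Z) ++ [Z.comap (blowup.π Z)]).map fun F => F.comap (blowup.π Z ⁻¹ᵁ D).ι)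
        ((𝒦.map fun A => A.map fun p => (p.1.comap (blowup.π Z ∣_ D), p.2)).map fun A =>
          A ++ [((⊤ : (↑(blowup.π Z ⁻¹ᵁ D) : Scheme.{u}).IdealSheafData), 0)])
        (labMove ((Λ.map fun F => F.comap D.ι).map fun F => F.comap (blowup.π Z ∣_ D)) lab e) ∧
      (controlledTransform (blowup.π Z) Z K m).comap (blowup.π Z ⁻¹ᵁ D).ι =
        monomialSum ((𝒦.map fun A => A.map fun p => (p.1.comap (blowup.π Z ∣_ D), p.2)).map fun A =>
          A ++ [((⊤ : (↑(blowup.π Z ⁻¹ᵁ D) : Scheme.{u}).IdealSheafData), 0)]) := by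
  haveI : IsLocallyNoetherian (blowup Z) := CentreSeq.isLocallyNoetherian_blowup Z
  obtain ⟨-, hginv, hE, hK'⟩ := pieceStep_offCentre Λ K Z D m hinv hK hZD
  have hL : ((Λ.map (strictTransformIdeal (blowup.π Z) Z) ++ [Z.comap (blowup.π Z)]).map fun F => F.comap (blowup.π Z ⁻¹ᵁ D).ι) =
      ((Λ.map (strictTransformIdeal (blowup.π Z) Z)).map fun F => F.comap (blowup.π Z ⁻¹ᵁ D).ι) ++ [⊤] := by
    rw [List.map_append, List.map_cons, List.map_nil, hE]
  have hL' : ((Λ.map (strictTransformIdeal (blowup.π Z) Z)).map fun F => F.comap (blowup.π Z ⁻¹ᵁ D).ι) =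
      (Λ.map fun F => F.comap D.ι).map fun F => F.comap (blowup.π Z ∣_ D) := by
    simp only [List.map_map, Function.comp_def, ← strictTransformIdeal_morphismRestrict, hZD,
      X3LemmaM.strictTransformIdeal_eq_comap_of_eq_top (blowup.π Z ∣_ D) rfl]
  refine ⟨?_, ?_⟩
  · rw [hL, hL']
    rw [hL'] at hginv
    exact gameInv_phantom hginv he
  · rw [monomialSum_map_append_top_zero]
    exact hK'

end MonomialCleanup

end Summit.ResolutionOfSingularities.ResolutionOfSingularities.Theorems

end
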